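import Summits.QuantumFields.YangMills.Theorems.FluctuationComparisonRegPrIntLS2BetaCritMQuaternionReadWindow
import Summits.QuantumFields.YangMills.Theorems.FluctuationComparisonRegPrIntLS2BetaMultOfPreimages
import Summits.QuantumFields.YangMills.Theorems.FluctuationComparisonRegPrIntLS2BetaBackgroundLetterOfThm1Pair
import HarnessLib

/-!
# S2β · THE (PRE) KNIT — «MULT♭-ax» FROM TWO NAMED LETTERS: ✓p824141's `hPre` assembled from the quaternion-read CRIT-m♮ THEOREM (Q1∕Q2) and the two remaining
# analytic letters (RINV-curl)_q and AVG₂♭-ax_q in the SAME currency; then «MULT♭-ax» itself, with (BKG) discharged by ✓p822405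

Cell `ym3-torus` (YM ladder rung R3 = continuum `SU(2)` Yang–Mills on the three-torus at fixed lattice data — a RUNG: NOT d = 4, NOT infinite volume, NOT a mass gap,
NOT Clay).  Width seat `ym3-torus-px5` (gen 22); crux `stmt-QuantumFields-20520` (`…Theses.UnitScaleTilt.FluctuationComparisonRegPrIntL`), LINE g18-1 S2β, organ GAP♯∘
⟸ «CRIT-ax» (✓p823293 `critAx_of_multAx`) ⟸ «MULT♭-ax» (✓p824141 `multAx_of_preimages (G) (Ax) (hPre) (hBkg)`); `--kind proof --supports stmt-QuantumFields-20520
--as helper`, count-neutral, DEFINITION-FREE (0 `def`, 0 `instance`, 0 `notation`, 0 `sorry`, default heartbeats).  Q4 of the quaternion-read series.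

THE TWO LETTERS (hypothesis texts, never asserted; each in ✓p824141's prefix with its own constant, `DM := DMq(U₀)` of ✓p825180 spelled out):
* (RINV-curl)_q `hR` — «PREIMAGES WITH SMALL COVARIANT CURL» (px16 g21's pen: face spreads (B1)(B2)(B3′)(B4)(B5) + px13 g25's (D2), door ✓`…PreimagesOfFaceSpreads`):
  `… ∃ γ₁ > 0, ∃ C_R ≥ 0, ∀ … ∀ U₀ ∈ argmin, ∀ v, ∃ ζ, DMq ζ = v ∧ Σ_p ‖(curl_{U₀} ζ)_p‖ ≤ C_R·L^{K−J}·Σ_B ‖v B‖`.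
* AVG₂♭-ax_q `hM` — «THE LINEARISED AVERAGE OF A FIBRE-MATE's CHORD IS SECOND ORDER» (px10 g23's pen): `… ∃ γ₁ > 0, ∃ C_M ≥ 0, ∀ … ∀ U₀ ∈ argmin, ∀ U ∈ fibre, histGood →
  Ax → Σ_B ‖DMq (ℓ ↦ imVec (su2Quat (U ℓ·U₀ ℓ⁻¹))) B‖ ≤ C_M·(L^{−(K−J)}·Σ_ℓ dist1² + L^{K−J}·Σ_p (1 − reTr(rel. plaquette)))`.

WHAT IS PROVED (sorry-free).
§1 ★★★`pre_of_letters (hT) (G) (Ax) (hR) (hM)` — ✓p824141's `hPre` text VERBATIM with `DM := DMq(U₀)`: the CRIT-m♮ set-form conjunct is the THEOREM ✓p825391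
   `qcritM_of_thm1Pair` (from the Thm-1 pair `hT` at every odd `L > 1` — ✓`thm1Pair_five` gives it at `L ≥ 5`, the `L = 3` pair is the [Balaban1985RegularSpaces] socket),
   the other two conjuncts are the letters; three prefixes merged (`min` of `c₀`∕`ε₁`∕`γ₁`, `max` of `pS`).  ★★★`pre_of_letters_of_thm1PairAtThree (h3)`.
§2 ★★★`multAx_of_letters (hT) (G) (Ax) (hR) (hM)` — **«MULT♭-ax» (✓p824141's conclusion VERBATIM) ⟸ Thm-1 pair ∧ (RINV-curl)_q ∧ AVG₂♭-ax_q**: ✓`multAx_of_preimages` fed §1 and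
   (BKG) := ✓p822405 `bkgLetter_of_thm1Pair hT G`; ★★★`multAx_of_letters_of_thm1PairAtThree (h3)`.  So, BY KERNEL: «CRIT-ax» ⟸ {h3, (RINV-curl)_q, AVG₂♭-ax_q} ∘ ✓p823293.

HONEST SCOPE.  Prefix plumbing; nothing of Bałaban's analysis is asserted or proved here; (RINV-curl)_q and AVG₂♭-ax_q are HYPOTHESES (exactly as open as before, now with
fixed binder texts for their dischargers); «CRIT-ax», (D-ax)∕(F-ax), GAP♯∘ (`stub_uniformFibreGapOrbit`, registry 3732b7df UNTOUCHED), S2β, the five registered stubs, 20520,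
`YM3TorusSU2` are NOT proved; rung R3 — NOT d = 4, NOT infinite volume, NOT a mass gap, NOT Clay.
-/

set_option autoImplicit false

noncomputable section

open scoped Matrix.Norms.L2Operator Topology RealInnerProductSpace
open Filter Set Function
open Literature.MathematicalPhysics.QuantumLattice (su2Quat)
open Literature.MathematicalPhysics.QuantumFieldTheory.Balaban1983to89
open Literature.MathematicalPhysics.QuantumFieldTheory.Balaban1983to89.Node00
open Literature.MathematicalPhysics.QuantumFieldTheory.Balaban1983to89.T3ContinuumYM3Torus
open Literature.MathematicalPhysics.QuantumFieldTheory.Balaban1983to89.T3UnitLawDensityEML (ℰp)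
open Literature.MathematicalPhysics.QuantumFieldTheory.Balaban1983to89.T3UnitScaleTilt
open Literature.MathematicalPhysics.QuantumFieldTheory.Balaban1983to89.T3TiltDescent
open Literature.MathematicalPhysics.QuantumFieldTheory.Balaban1983to89.T3ConstrainedMinimiser (fibre)
open Literature.MathematicalPhysics.QuantumFieldTheory.Balaban1983to89.T3DescentFibreTower
open Literature.MathematicalPhysics.QuantumFieldTheory.Balaban1983to89.T3PrintedRegularMinimiser
open Literature.MathematicalPhysics.QuantumFieldTheory.Balaban1983to89.T3PrintedMinimiserExistence
open Literature.MathematicalPhysics.QuantumFieldTheory.Balaban1983to89.T3Thm1UniquenessSchema (Thm1UniqueMinOrbitAt)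
open Literature.MathematicalPhysics.QuantumFieldTheory.Balaban1983to89.T4HaarSU2ExpChart (expPoint)
open Literature.MathematicalPhysics.QuantumFieldTheory.Balaban1983to89.T4ExpWindowSmallField (imVec)
open Literature.MathematicalPhysics.QuantumFieldTheory.Balaban1983to89.B15Prop1ChartSU2 (adSU2)
open Literature.MathematicalPhysics.QuantumFieldTheory.Balaban1983to89.T4Continuum
open Summit.QuantumFields.YangMills.Theorems.FluctuationComparisonRegPrIntLS2BetaSymmetriesLiftOfCritical (thm1Pair_allL_of_three)
open Summit.QuantumFields.YangMills.Theorems.FluctuationComparisonRegPrIntLS2BetaCritMQuaternionReadWindow (qcritM_of_thm1Pair)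
open Summit.QuantumFields.YangMills.Theorems.FluctuationComparisonRegPrIntLS2BetaMultOfPreimages (multAx_of_preimages)
open Summit.QuantumFields.YangMills.Theorems.FluctuationComparisonRegPrIntLS2BetaBackgroundLetterOfThm1Pair (bkgLetter_of_thm1Pair)

namespace Summit.QuantumFields.YangMills.Theorems.FluctuationComparisonRegPrIntLS2BetaPreOfLetters

/-! ## §1 (PRE) from the CRIT-m♮ theorem and the two letters -/

/-- ★★★ **✓p824141's (PRE) FROM THE QUATERNION-READ CRIT-m♮ THEOREM AND THE TWO LETTERS (RINV-curl)_q ∕ AVG₂♭-ax_q** (`DM := DMq(U₀)`; prefixes merged).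
[cite: Balaban1985Variational, Thm 1 (8)-(10) p.279, (26) p.282, (34) p.283; Balaban1987RG1, (0.4) p.253, (0.21)-(0.22) p.256] -/
theorem pre_of_letters
    (hT : ∀ L : ℕ, Odd L → 1 < L → ∃ a₀ a₁ B₃ : ℝ, 0 < a₀ ∧ 0 < a₁ ∧ 0 < B₃ ∧ Thm1GlobalMinAt L a₀ a₁ B₃ ∧ Thm1UniqueMinOrbitAt L a₀ a₁ B₃)
    (G : (F : T3Family) → (J : ℕ) → GaugeField (F.P J) 0 (Matrix.specialUnitaryGroup (Fin 2) ℂ) → Prop)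
    (Ax : (F : T3Family) → (J K : ℕ) → (hJK : J ≤ K) → GaugeField (F.P K) 0 (Matrix.specialUnitaryGroup (Fin 2) ℂ) →
      GaugeField (F.P K) 0 (Matrix.specialUnitaryGroup (Fin 2) ℂ) → Prop)
    (hR : ∀ (L : ℕ), ∃ c₀ : ℝ, 0 < c₀ ∧ c₀ ≤ 1 ∧ ∀ (cw : ℝ), 0 < cw → cw ≤ c₀ → ∃ pS : ℝ, ∀ (b₀ p₀ : ℝ), 0 < b₀ → pS ≤ p₀ → 0 < p₀ → ∃ ε₁ : ℝ, 0 < ε₁ ∧ ∀ (ε₀ : ℝ), 0 < ε₀ → ε₀ ≤ ε₁ →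
    ∃ γ₁ : ℝ, 0 < γ₁ ∧ ∃ C_R : ℝ, 0 ≤ C_R ∧ ∀ (F : T3Family) (γ : ℝ), F.L = L → 0 < γ → γ ≤ γ₁ →
      ∀ (J K : ℕ) (hJK : J ≤ K) (V : GaugeField (F.P J) 0 (Matrix.specialUnitaryGroup (Fin 2) ℂ)), PlaqSmall (θBal F.L γ (cw * b₀) p₀ J) V →
        G F J V →
        ∀ U₀ ∈ {U' : GaugeField (F.P K) 0 (Matrix.specialUnitaryGroup (Fin 2) ℂ) | U' ∈ fibre F ℰp J K hJK V ∧ U' ∈ histGood F ℰp (θBal F.L γ b₀ p₀) K J ∧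
            wilsonAction4 U' = minActionRegPr F J K hJK ε₀ V},
        ∀ v : PBond (F.P J) 0 → EuclideanSpace ℝ (Fin 3), ∃ ζ : PBond (F.P K) 0 → EuclideanSpace ℝ (Fin 3), (fderiv ℝ (fun (ζ : PBond (F.P K) 0 → EuclideanSpace ℝ (Fin 3)) (B : PBond (F.P J) 0) =>
            imVec (su2Quat (descendTo F ℰp J K hJK (fun ℓ => expPoint (ζ ℓ) * U₀ ℓ) B * (descendTo F ℰp J K hJK U₀ B)⁻¹))) 0) ζ = v ∧
            ∑ p : Plaq (F.P K) 0, ‖adSU2 (GaugeField.plaqHol U₀ p)⁻¹ (ζ ⟨p.src, p.μ⟩) + adSU2 ((GaugeField.plaqHol U₀ p)⁻¹ * U₀ ⟨p.src, p.μ⟩) (ζ ⟨p.src.shift p.μ, p.ν⟩) -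
                  adSU2 ((GaugeField.plaqHol U₀ p)⁻¹ * U₀ ⟨p.src, p.μ⟩ * U₀ ⟨p.src.shift p.μ, p.ν⟩ * (U₀ ⟨p.src.shift p.ν, p.μ⟩)⁻¹) (ζ ⟨p.src.shift p.ν, p.μ⟩) -
                  ζ ⟨p.src, p.ν⟩‖ ≤
              C_R * (F.L : ℝ) ^ (K - J) * ∑ B : PBond (F.P J) 0, ‖v B‖)
    (hM : ∀ (L : ℕ), ∃ c₀ : ℝ, 0 < c₀ ∧ c₀ ≤ 1 ∧ ∀ (cw : ℝ), 0 < cw → cw ≤ c₀ → ∃ pS : ℝ, ∀ (b₀ p₀ : ℝ), 0 < b₀ → pS ≤ p₀ → 0 < p₀ → ∃ ε₁ : ℝ, 0 < ε₁ ∧ ∀ (ε₀ : ℝ), 0 < ε₀ → ε₀ ≤ ε₁ →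
    ∃ γ₁ : ℝ, 0 < γ₁ ∧ ∃ C_M : ℝ, 0 ≤ C_M ∧ ∀ (F : T3Family) (γ : ℝ), F.L = L → 0 < γ → γ ≤ γ₁ →
      ∀ (J K : ℕ) (hJK : J ≤ K) (V : GaugeField (F.P J) 0 (Matrix.specialUnitaryGroup (Fin 2) ℂ)), PlaqSmall (θBal F.L γ (cw * b₀) p₀ J) V →
        G F J V →
        ∀ U₀ ∈ {U' : GaugeField (F.P K) 0 (Matrix.specialUnitaryGroup (Fin 2) ℂ) | U' ∈ fibre F ℰp J K hJK V ∧ U' ∈ histGood F ℰp (θBal F.L γ b₀ p₀) K J ∧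
            wilsonAction4 U' = minActionRegPr F J K hJK ε₀ V},
        ∀ U ∈ fibre F ℰp J K hJK V, U ∈ histGood F ℰp (θBal F.L γ b₀ p₀) K J →
            Ax F J K hJK U U₀ →
            ∑ B : PBond (F.P J) 0, ‖(fderiv ℝ (fun (ζ : PBond (F.P K) 0 → EuclideanSpace ℝ (Fin 3)) (B : PBond (F.P J) 0) =>
            imVec (su2Quat (descendTo F ℰp J K hJK (fun ℓ => expPoint (ζ ℓ) * U₀ ℓ) B * (descendTo F ℰp J K hJK U₀ B)⁻¹))) 0) (fun ℓ => imVec (su2Quat (U ℓ * (U₀ ℓ)⁻¹))) B‖ ≤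
              C_M * (((F.L : ℝ)⁻¹) ^ (K - J) * ∑ ℓ : PBond (F.P K) 0, dist1 (U ℓ * (U₀ ℓ)⁻¹) ^ 2 +
                (F.L : ℝ) ^ (K - J) * ∑ p : Plaq (F.P K) 0, (1 - reTr ((GaugeField.plaqHol U₀ p)⁻¹ * GaugeField.plaqHol U p)))) :
    ∀ (L : ℕ), ∃ c₀ : ℝ, 0 < c₀ ∧ c₀ ≤ 1 ∧ ∀ (cw : ℝ), 0 < cw → cw ≤ c₀ → ∃ pS : ℝ, ∀ (b₀ p₀ : ℝ), 0 < b₀ → pS ≤ p₀ → 0 < p₀ → ∃ ε₁ : ℝ, 0 < ε₁ ∧ ∀ (ε₀ : ℝ), 0 < ε₀ → ε₀ ≤ ε₁ →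
    ∃ γ₁ : ℝ, 0 < γ₁ ∧ ∃ C_R : ℝ, 0 ≤ C_R ∧ ∃ C_M : ℝ, 0 ≤ C_M ∧ ∀ (F : T3Family) (γ : ℝ), F.L = L → 0 < γ → γ ≤ γ₁ →
      ∀ (J K : ℕ) (hJK : J ≤ K) (V : GaugeField (F.P J) 0 (Matrix.specialUnitaryGroup (Fin 2) ℂ)), PlaqSmall (θBal F.L γ (cw * b₀) p₀ J) V →
        G F J V →
        ∀ U₀ ∈ {U' : GaugeField (F.P K) 0 (Matrix.specialUnitaryGroup (Fin 2) ℂ) | U' ∈ fibre F ℰp J K hJK V ∧ U' ∈ histGood F ℰp (θBal F.L γ b₀ p₀) K J ∧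
            wilsonAction4 U' = minActionRegPr F J K hJK ε₀ V},
        ∃ (DM : (PBond (F.P K) 0 → EuclideanSpace ℝ (Fin 3)) → (PBond (F.P J) 0 → EuclideanSpace ℝ (Fin 3))),
          (∀ ζ ζ' : PBond (F.P K) 0 → EuclideanSpace ℝ (Fin 3), DM ζ = DM ζ' →
            (∑ p : Plaq (F.P K) 0, inner ℝ (imVec (su2Quat (GaugeField.plaqHol U₀ p)))
              (adSU2 (GaugeField.plaqHol U₀ p)⁻¹ (ζ ⟨p.src, p.μ⟩) + adSU2 ((GaugeField.plaqHol U₀ p)⁻¹ * U₀ ⟨p.src, p.μ⟩) (ζ ⟨p.src.shift p.μ, p.ν⟩) -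
                adSU2 ((GaugeField.plaqHol U₀ p)⁻¹ * U₀ ⟨p.src, p.μ⟩ * U₀ ⟨p.src.shift p.μ, p.ν⟩ * (U₀ ⟨p.src.shift p.ν, p.μ⟩)⁻¹) (ζ ⟨p.src.shift p.ν, p.μ⟩) -
                ζ ⟨p.src, p.ν⟩)) =
            (∑ p : Plaq (F.P K) 0, inner ℝ (imVec (su2Quat (GaugeField.plaqHol U₀ p)))
              (adSU2 (GaugeField.plaqHol U₀ p)⁻¹ (ζ' ⟨p.src, p.μ⟩) + adSU2 ((GaugeField.plaqHol U₀ p)⁻¹ * U₀ ⟨p.src, p.μ⟩) (ζ' ⟨p.src.shift p.μ, p.ν⟩) -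
                adSU2 ((GaugeField.plaqHol U₀ p)⁻¹ * U₀ ⟨p.src, p.μ⟩ * U₀ ⟨p.src.shift p.μ, p.ν⟩ * (U₀ ⟨p.src.shift p.ν, p.μ⟩)⁻¹) (ζ' ⟨p.src.shift p.ν, p.μ⟩) -
                ζ' ⟨p.src, p.ν⟩))) ∧
          (∀ v : PBond (F.P J) 0 → EuclideanSpace ℝ (Fin 3), ∃ ζ : PBond (F.P K) 0 → EuclideanSpace ℝ (Fin 3), DM ζ = v ∧
            ∑ p : Plaq (F.P K) 0, ‖adSU2 (GaugeField.plaqHol U₀ p)⁻¹ (ζ ⟨p.src, p.μ⟩) + adSU2 ((GaugeField.plaqHol U₀ p)⁻¹ * U₀ ⟨p.src, p.μ⟩) (ζ ⟨p.src.shift p.μ, p.ν⟩) -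
                  adSU2 ((GaugeField.plaqHol U₀ p)⁻¹ * U₀ ⟨p.src, p.μ⟩ * U₀ ⟨p.src.shift p.μ, p.ν⟩ * (U₀ ⟨p.src.shift p.ν, p.μ⟩)⁻¹) (ζ ⟨p.src.shift p.ν, p.μ⟩) -
                  ζ ⟨p.src, p.ν⟩‖ ≤
              C_R * (F.L : ℝ) ^ (K - J) * ∑ B : PBond (F.P J) 0, ‖v B‖) ∧
          ∀ U ∈ fibre F ℰp J K hJK V, U ∈ histGood F ℰp (θBal F.L γ b₀ p₀) K J →
            Ax F J K hJK U U₀ →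
            ∑ B : PBond (F.P J) 0, ‖DM (fun ℓ => imVec (su2Quat (U ℓ * (U₀ ℓ)⁻¹))) B‖ ≤
              C_M * (((F.L : ℝ)⁻¹) ^ (K - J) * ∑ ℓ : PBond (F.P K) 0, dist1 (U ℓ * (U₀ ℓ)⁻¹) ^ 2 +
                (F.L : ℝ) ^ (K - J) * ∑ p : Plaq (F.P K) 0, (1 - reTr ((GaugeField.plaqHol U₀ p)⁻¹ * GaugeField.plaqHol U p))) := by
  intro L
  obtain ⟨c₁, hc₁, hc₁1, H1⟩ := hR L
  obtain ⟨c₂, hc₂, -, H2⟩ := hM L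
  obtain ⟨c₃, hc₃, -, H3⟩ := qcritM_of_thm1Pair hT G L
  refine ⟨min c₁ (min c₂ c₃), lt_min hc₁ (lt_min hc₂ hc₃), (min_le_left _ _).trans hc₁1, ?_⟩
  intro cw hcw hcwle
  obtain ⟨pS₁, H1⟩ := H1 cw hcw (hcwle.trans (min_le_left _ _))
  obtain ⟨pS₂, H2⟩ := H2 cw hcw (hcwle.trans ((min_le_right _ _).trans (min_le_left _ _)))
  obtain ⟨pS₃, H3⟩ := H3 cw hcw (hcwle.trans ((min_le_right _ _).trans (min_le_right _ _)))
  refine ⟨max pS₁ (max pS₂ pS₃), ?_⟩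
  intro b₀ p₀ hb hpS hp
  obtain ⟨e₁, he₁, H1⟩ := H1 b₀ p₀ hb ((le_max_left _ _).trans hpS) hp
  obtain ⟨e₂, he₂, H2⟩ := H2 b₀ p₀ hb (((le_max_left _ _).trans (le_max_right _ _)).trans hpS) hp
  obtain ⟨e₃, he₃, H3⟩ := H3 b₀ p₀ hb (((le_max_right _ _).trans (le_max_right _ _)).trans hpS) hp
  refine ⟨min e₁ (min e₂ e₃), lt_min he₁ (lt_min he₂ he₃), ?_⟩
  intro ε₀ hε₀ hε₀le
  obtain ⟨γA, hγA, C_R, hCR, H1⟩ := H1 ε₀ hε₀ (hε₀le.trans (min_le_left _ _))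
  obtain ⟨γB, hγB, C_M, hCM, H2⟩ := H2 ε₀ hε₀ (hε₀le.trans ((min_le_right _ _).trans (min_le_left _ _)))
  obtain ⟨γC, hγC, H3⟩ := H3 ε₀ hε₀ (hε₀le.trans ((min_le_right _ _).trans (min_le_right _ _)))
  refine ⟨min γA (min γB γC), lt_min hγA (lt_min hγB hγC), C_R, hCR, C_M, hCM, ?_⟩
  intro F γ hFL hγ hγle J K hJK V hV hG U₀ hU₀
  have h1 := H1 F γ hFL hγ (hγle.trans (min_le_left _ _)) J K hJK V hV hG U₀ hU₀
  have h2 := H2 F γ hFL hγ (hγle.trans ((min_le_right _ _).trans (min_le_left _ _))) J K hJK V hV hG U₀ hU₀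
  obtain ⟨-, hset, -⟩ := H3 F γ hFL hγ (hγle.trans ((min_le_right _ _).trans (min_le_right _ _))) J K hJK V hV hG U₀ hU₀
  exact ⟨_, hset, h1, h2⟩

/-- ★★★ **… FROM THE `L = 3` THM-1 PAIR** (every `L ≥ 5` by ✓`thm1Pair_five`). [cite: Balaban1985Variational, Thm 1 p.279; Balaban1985RegularSpaces, Thm 2 p.83] -/
theorem pre_of_letters_of_thm1PairAtThree
    (h3 : ∃ a₀ a₁ B₃ : ℝ, 0 < a₀ ∧ 0 < a₁ ∧ 0 < B₃ ∧ Thm1GlobalMinAt 3 a₀ a₁ B₃ ∧ Thm1UniqueMinOrbitAt 3 a₀ a₁ B₃)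
    (G : (F : T3Family) → (J : ℕ) → GaugeField (F.P J) 0 (Matrix.specialUnitaryGroup (Fin 2) ℂ) → Prop)
    (Ax : (F : T3Family) → (J K : ℕ) → (hJK : J ≤ K) → GaugeField (F.P K) 0 (Matrix.specialUnitaryGroup (Fin 2) ℂ) →
      GaugeField (F.P K) 0 (Matrix.specialUnitaryGroup (Fin 2) ℂ) → Prop)
    (hR : ∀ (L : ℕ), ∃ c₀ : ℝ, 0 < c₀ ∧ c₀ ≤ 1 ∧ ∀ (cw : ℝ), 0 < cw → cw ≤ c₀ → ∃ pS : ℝ, ∀ (b₀ p₀ : ℝ), 0 < b₀ → pS ≤ p₀ → 0 < p₀ → ∃ ε₁ : ℝ, 0 < ε₁ ∧ ∀ (ε₀ : ℝ), 0 < ε₀ → ε₀ ≤ ε₁ →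
    ∃ γ₁ : ℝ, 0 < γ₁ ∧ ∃ C_R : ℝ, 0 ≤ C_R ∧ ∀ (F : T3Family) (γ : ℝ), F.L = L → 0 < γ → γ ≤ γ₁ →
      ∀ (J K : ℕ) (hJK : J ≤ K) (V : GaugeField (F.P J) 0 (Matrix.specialUnitaryGroup (Fin 2) ℂ)), PlaqSmall (θBal F.L γ (cw * b₀) p₀ J) V →
        G F J V →
        ∀ U₀ ∈ {U' : GaugeField (F.P K) 0 (Matrix.specialUnitaryGroup (Fin 2) ℂ) | U' ∈ fibre F ℰp J K hJK V ∧ U' ∈ histGood F ℰp (θBal F.L γ b₀ p₀) K J ∧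
            wilsonAction4 U' = minActionRegPr F J K hJK ε₀ V},
        ∀ v : PBond (F.P J) 0 → EuclideanSpace ℝ (Fin 3), ∃ ζ : PBond (F.P K) 0 → EuclideanSpace ℝ (Fin 3), (fderiv ℝ (fun (ζ : PBond (F.P K) 0 → EuclideanSpace ℝ (Fin 3)) (B : PBond (F.P J) 0) =>
            imVec (su2Quat (descendTo F ℰp J K hJK (fun ℓ => expPoint (ζ ℓ) * U₀ ℓ) B * (descendTo F ℰp J K hJK U₀ B)⁻¹))) 0) ζ = v ∧
            ∑ p : Plaq (F.P K) 0, ‖adSU2 (GaugeField.plaqHol U₀ p)⁻¹ (ζ ⟨p.src, p.μ⟩) + adSU2 ((GaugeField.plaqHol U₀ p)⁻¹ * U₀ ⟨p.src, p.μ⟩) (ζ ⟨p.src.shift p.μ, p.ν⟩) -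
                  adSU2 ((GaugeField.plaqHol U₀ p)⁻¹ * U₀ ⟨p.src, p.μ⟩ * U₀ ⟨p.src.shift p.μ, p.ν⟩ * (U₀ ⟨p.src.shift p.ν, p.μ⟩)⁻¹) (ζ ⟨p.src.shift p.ν, p.μ⟩) -
                  ζ ⟨p.src, p.ν⟩‖ ≤
              C_R * (F.L : ℝ) ^ (K - J) * ∑ B : PBond (F.P J) 0, ‖v B‖)
    (hM : ∀ (L : ℕ), ∃ c₀ : ℝ, 0 < c₀ ∧ c₀ ≤ 1 ∧ ∀ (cw : ℝ), 0 < cw → cw ≤ c₀ → ∃ pS : ℝ, ∀ (b₀ p₀ : ℝ), 0 < b₀ → pS ≤ p₀ → 0 < p₀ → ∃ ε₁ : ℝ, 0 < ε₁ ∧ ∀ (ε₀ : ℝ), 0 < ε₀ → ε₀ ≤ ε₁ →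
    ∃ γ₁ : ℝ, 0 < γ₁ ∧ ∃ C_M : ℝ, 0 ≤ C_M ∧ ∀ (F : T3Family) (γ : ℝ), F.L = L → 0 < γ → γ ≤ γ₁ →
      ∀ (J K : ℕ) (hJK : J ≤ K) (V : GaugeField (F.P J) 0 (Matrix.specialUnitaryGroup (Fin 2) ℂ)), PlaqSmall (θBal F.L γ (cw * b₀) p₀ J) V →
        G F J V →
        ∀ U₀ ∈ {U' : GaugeField (F.P K) 0 (Matrix.specialUnitaryGroup (Fin 2) ℂ) | U' ∈ fibre F ℰp J K hJK V ∧ U' ∈ histGood F ℰp (θBal F.L γ b₀ p₀) K J ∧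
            wilsonAction4 U' = minActionRegPr F J K hJK ε₀ V},
        ∀ U ∈ fibre F ℰp J K hJK V, U ∈ histGood F ℰp (θBal F.L γ b₀ p₀) K J →
            Ax F J K hJK U U₀ →
            ∑ B : PBond (F.P J) 0, ‖(fderiv ℝ (fun (ζ : PBond (F.P K) 0 → EuclideanSpace ℝ (Fin 3)) (B : PBond (F.P J) 0) =>
            imVec (su2Quat (descendTo F ℰp J K hJK (fun ℓ => expPoint (ζ ℓ) * U₀ ℓ) B * (descendTo F ℰp J K hJK U₀ B)⁻¹))) 0) (fun ℓ => imVec (su2Quat (U ℓ * (U₀ ℓ)⁻¹))) B‖ ≤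
              C_M * (((F.L : ℝ)⁻¹) ^ (K - J) * ∑ ℓ : PBond (F.P K) 0, dist1 (U ℓ * (U₀ ℓ)⁻¹) ^ 2 +
                (F.L : ℝ) ^ (K - J) * ∑ p : Plaq (F.P K) 0, (1 - reTr ((GaugeField.plaqHol U₀ p)⁻¹ * GaugeField.plaqHol U p)))) :
    ∀ (L : ℕ), ∃ c₀ : ℝ, 0 < c₀ ∧ c₀ ≤ 1 ∧ ∀ (cw : ℝ), 0 < cw → cw ≤ c₀ → ∃ pS : ℝ, ∀ (b₀ p₀ : ℝ), 0 < b₀ → pS ≤ p₀ → 0 < p₀ → ∃ ε₁ : ℝ, 0 < ε₁ ∧ ∀ (ε₀ : ℝ), 0 < ε₀ → ε₀ ≤ ε₁ →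
    ∃ γ₁ : ℝ, 0 < γ₁ ∧ ∃ C_R : ℝ, 0 ≤ C_R ∧ ∃ C_M : ℝ, 0 ≤ C_M ∧ ∀ (F : T3Family) (γ : ℝ), F.L = L → 0 < γ → γ ≤ γ₁ →
      ∀ (J K : ℕ) (hJK : J ≤ K) (V : GaugeField (F.P J) 0 (Matrix.specialUnitaryGroup (Fin 2) ℂ)), PlaqSmall (θBal F.L γ (cw * b₀) p₀ J) V →
        G F J V →
        ∀ U₀ ∈ {U' : GaugeField (F.P K) 0 (Matrix.specialUnitaryGroup (Fin 2) ℂ) | U' ∈ fibre F ℰp J K hJK V ∧ U' ∈ histGood F ℰp (θBal F.L γ b₀ p₀) K J ∧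
            wilsonAction4 U' = minActionRegPr F J K hJK ε₀ V},
        ∃ (DM : (PBond (F.P K) 0 → EuclideanSpace ℝ (Fin 3)) → (PBond (F.P J) 0 → EuclideanSpace ℝ (Fin 3))),
          (∀ ζ ζ' : PBond (F.P K) 0 → EuclideanSpace ℝ (Fin 3), DM ζ = DM ζ' →
            (∑ p : Plaq (F.P K) 0, inner ℝ (imVec (su2Quat (GaugeField.plaqHol U₀ p)))
              (adSU2 (GaugeField.plaqHol U₀ p)⁻¹ (ζ ⟨p.src, p.μ⟩) + adSU2 ((GaugeField.plaqHol U₀ p)⁻¹ * U₀ ⟨p.src, p.μ⟩) (ζ ⟨p.src.shift p.μ, p.ν⟩) -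
                adSU2 ((GaugeField.plaqHol U₀ p)⁻¹ * U₀ ⟨p.src, p.μ⟩ * U₀ ⟨p.src.shift p.μ, p.ν⟩ * (U₀ ⟨p.src.shift p.ν, p.μ⟩)⁻¹) (ζ ⟨p.src.shift p.ν, p.μ⟩) -
                ζ ⟨p.src, p.ν⟩)) =
            (∑ p : Plaq (F.P K) 0, inner ℝ (imVec (su2Quat (GaugeField.plaqHol U₀ p)))
              (adSU2 (GaugeField.plaqHol U₀ p)⁻¹ (ζ' ⟨p.src, p.μ⟩) + adSU2 ((GaugeField.plaqHol U₀ p)⁻¹ * U₀ ⟨p.src, p.μ⟩) (ζ' ⟨p.src.shift p.μ, p.ν⟩) -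
                adSU2 ((GaugeField.plaqHol U₀ p)⁻¹ * U₀ ⟨p.src, p.μ⟩ * U₀ ⟨p.src.shift p.μ, p.ν⟩ * (U₀ ⟨p.src.shift p.ν, p.μ⟩)⁻¹) (ζ' ⟨p.src.shift p.ν, p.μ⟩) -
                ζ' ⟨p.src, p.ν⟩))) ∧
          (∀ v : PBond (F.P J) 0 → EuclideanSpace ℝ (Fin 3), ∃ ζ : PBond (F.P K) 0 → EuclideanSpace ℝ (Fin 3), DM ζ = v ∧
            ∑ p : Plaq (F.P K) 0, ‖adSU2 (GaugeField.plaqHol U₀ p)⁻¹ (ζ ⟨p.src, p.μ⟩) + adSU2 ((GaugeField.plaqHol U₀ p)⁻¹ * U₀ ⟨p.src, p.μ⟩) (ζ ⟨p.src.shift p.μ, p.ν⟩) -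
                  adSU2 ((GaugeField.plaqHol U₀ p)⁻¹ * U₀ ⟨p.src, p.μ⟩ * U₀ ⟨p.src.shift p.μ, p.ν⟩ * (U₀ ⟨p.src.shift p.ν, p.μ⟩)⁻¹) (ζ ⟨p.src.shift p.ν, p.μ⟩) -
                  ζ ⟨p.src, p.ν⟩‖ ≤
              C_R * (F.L : ℝ) ^ (K - J) * ∑ B : PBond (F.P J) 0, ‖v B‖) ∧
          ∀ U ∈ fibre F ℰp J K hJK V, U ∈ histGood F ℰp (θBal F.L γ b₀ p₀) K J →
            Ax F J K hJK U U₀ →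
            ∑ B : PBond (F.P J) 0, ‖DM (fun ℓ => imVec (su2Quat (U ℓ * (U₀ ℓ)⁻¹))) B‖ ≤
              C_M * (((F.L : ℝ)⁻¹) ^ (K - J) * ∑ ℓ : PBond (F.P K) 0, dist1 (U ℓ * (U₀ ℓ)⁻¹) ^ 2 +
                (F.L : ℝ) ^ (K - J) * ∑ p : Plaq (F.P K) 0, (1 - reTr ((GaugeField.plaqHol U₀ p)⁻¹ * GaugeField.plaqHol U p))) :=
  pre_of_letters (thm1Pair_allL_of_three h3) G Ax hR hM

/-! ## §2 «MULT♭-ax» from the Thm-1 pair and the two letters ((BKG) discharged by ✓p822405) -/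

/-- ★★★ **«MULT♭-ax» (✓p824141's conclusion VERBATIM) ⟸ Thm-1 pair ∧ (RINV-curl)_q ∧ AVG₂♭-ax_q**: ✓`multAx_of_preimages` ∘ §1 ∘ ✓p822405 `bkgLetter_of_thm1Pair`.
[cite: Balaban1987RG1, (0.21)-(0.22) p.256; Balaban1985Variational, Thm 1 (8)-(10) p.279, (34) p.283] -/
theorem multAx_of_letters
    (hT : ∀ L : ℕ, Odd L → 1 < L → ∃ a₀ a₁ B₃ : ℝ, 0 < a₀ ∧ 0 < a₁ ∧ 0 < B₃ ∧ Thm1GlobalMinAt L a₀ a₁ B₃ ∧ Thm1UniqueMinOrbitAt L a₀ a₁ B₃)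
    (G : (F : T3Family) → (J : ℕ) → GaugeField (F.P J) 0 (Matrix.specialUnitaryGroup (Fin 2) ℂ) → Prop)
    (Ax : (F : T3Family) → (J K : ℕ) → (hJK : J ≤ K) → GaugeField (F.P K) 0 (Matrix.specialUnitaryGroup (Fin 2) ℂ) →
      GaugeField (F.P K) 0 (Matrix.specialUnitaryGroup (Fin 2) ℂ) → Prop)
    (hR : ∀ (L : ℕ), ∃ c₀ : ℝ, 0 < c₀ ∧ c₀ ≤ 1 ∧ ∀ (cw : ℝ), 0 < cw → cw ≤ c₀ → ∃ pS : ℝ, ∀ (b₀ p₀ : ℝ), 0 < b₀ → pS ≤ p₀ → 0 < p₀ → ∃ ε₁ : ℝ, 0 < ε₁ ∧ ∀ (ε₀ : ℝ), 0 < ε₀ → ε₀ ≤ ε₁ →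
    ∃ γ₁ : ℝ, 0 < γ₁ ∧ ∃ C_R : ℝ, 0 ≤ C_R ∧ ∀ (F : T3Family) (γ : ℝ), F.L = L → 0 < γ → γ ≤ γ₁ →
      ∀ (J K : ℕ) (hJK : J ≤ K) (V : GaugeField (F.P J) 0 (Matrix.specialUnitaryGroup (Fin 2) ℂ)), PlaqSmall (θBal F.L γ (cw * b₀) p₀ J) V →
        G F J V →
        ∀ U₀ ∈ {U' : GaugeField (F.P K) 0 (Matrix.specialUnitaryGroup (Fin 2) ℂ) | U' ∈ fibre F ℰp J K hJK V ∧ U' ∈ histGood F ℰp (θBal F.L γ b₀ p₀) K J ∧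
            wilsonAction4 U' = minActionRegPr F J K hJK ε₀ V},
        ∀ v : PBond (F.P J) 0 → EuclideanSpace ℝ (Fin 3), ∃ ζ : PBond (F.P K) 0 → EuclideanSpace ℝ (Fin 3), (fderiv ℝ (fun (ζ : PBond (F.P K) 0 → EuclideanSpace ℝ (Fin 3)) (B : PBond (F.P J) 0) =>
            imVec (su2Quat (descendTo F ℰp J K hJK (fun ℓ => expPoint (ζ ℓ) * U₀ ℓ) B * (descendTo F ℰp J K hJK U₀ B)⁻¹))) 0) ζ = v ∧
            ∑ p : Plaq (F.P K) 0, ‖adSU2 (GaugeField.plaqHol U₀ p)⁻¹ (ζ ⟨p.src, p.μ⟩) + adSU2 ((GaugeField.plaqHol U₀ p)⁻¹ * U₀ ⟨p.src, p.μ⟩) (ζ ⟨p.src.shift p.μ, p.ν⟩) -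
                  adSU2 ((GaugeField.plaqHol U₀ p)⁻¹ * U₀ ⟨p.src, p.μ⟩ * U₀ ⟨p.src.shift p.μ, p.ν⟩ * (U₀ ⟨p.src.shift p.ν, p.μ⟩)⁻¹) (ζ ⟨p.src.shift p.ν, p.μ⟩) -
                  ζ ⟨p.src, p.ν⟩‖ ≤
              C_R * (F.L : ℝ) ^ (K - J) * ∑ B : PBond (F.P J) 0, ‖v B‖)
    (hM : ∀ (L : ℕ), ∃ c₀ : ℝ, 0 < c₀ ∧ c₀ ≤ 1 ∧ ∀ (cw : ℝ), 0 < cw → cw ≤ c₀ → ∃ pS : ℝ, ∀ (b₀ p₀ : ℝ), 0 < b₀ → pS ≤ p₀ → 0 < p₀ → ∃ ε₁ : ℝ, 0 < ε₁ ∧ ∀ (ε₀ : ℝ), 0 < ε₀ → ε₀ ≤ ε₁ →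
    ∃ γ₁ : ℝ, 0 < γ₁ ∧ ∃ C_M : ℝ, 0 ≤ C_M ∧ ∀ (F : T3Family) (γ : ℝ), F.L = L → 0 < γ → γ ≤ γ₁ →
      ∀ (J K : ℕ) (hJK : J ≤ K) (V : GaugeField (F.P J) 0 (Matrix.specialUnitaryGroup (Fin 2) ℂ)), PlaqSmall (θBal F.L γ (cw * b₀) p₀ J) V →
        G F J V →
        ∀ U₀ ∈ {U' : GaugeField (F.P K) 0 (Matrix.specialUnitaryGroup (Fin 2) ℂ) | U' ∈ fibre F ℰp J K hJK V ∧ U' ∈ histGood F ℰp (θBal F.L γ b₀ p₀) K J ∧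
            wilsonAction4 U' = minActionRegPr F J K hJK ε₀ V},
        ∀ U ∈ fibre F ℰp J K hJK V, U ∈ histGood F ℰp (θBal F.L γ b₀ p₀) K J →
            Ax F J K hJK U U₀ →
            ∑ B : PBond (F.P J) 0, ‖(fderiv ℝ (fun (ζ : PBond (F.P K) 0 → EuclideanSpace ℝ (Fin 3)) (B : PBond (F.P J) 0) =>
            imVec (su2Quat (descendTo F ℰp J K hJK (fun ℓ => expPoint (ζ ℓ) * U₀ ℓ) B * (descendTo F ℰp J K hJK U₀ B)⁻¹))) 0) (fun ℓ => imVec (su2Quat (U ℓ * (U₀ ℓ)⁻¹))) B‖ ≤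
              C_M * (((F.L : ℝ)⁻¹) ^ (K - J) * ∑ ℓ : PBond (F.P K) 0, dist1 (U ℓ * (U₀ ℓ)⁻¹) ^ 2 +
                (F.L : ℝ) ^ (K - J) * ∑ p : Plaq (F.P K) 0, (1 - reTr ((GaugeField.plaqHol U₀ p)⁻¹ * GaugeField.plaqHol U p)))) :
    ∀ (L : ℕ), ∃ c₀ : ℝ, 0 < c₀ ∧ c₀ ≤ 1 ∧ ∀ (cw : ℝ), 0 < cw → cw ≤ c₀ → ∃ pS : ℝ, ∀ (b₀ p₀ : ℝ), 0 < b₀ → pS ≤ p₀ → 0 < p₀ → ∃ ε₁ : ℝ, 0 < ε₁ ∧ ∀ (ε₀ : ℝ), 0 < ε₀ → ε₀ ≤ ε₁ →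
    ∃ γ₁ : ℝ, 0 < γ₁ ∧ ∃ C_lam : ℝ, 0 ≤ C_lam ∧ ∃ C_M : ℝ, 0 ≤ C_M ∧ ∀ (F : T3Family) (γ : ℝ), F.L = L → 0 < γ → γ ≤ γ₁ →
      ∀ (J K : ℕ) (hJK : J ≤ K) (V : GaugeField (F.P J) 0 (Matrix.specialUnitaryGroup (Fin 2) ℂ)), PlaqSmall (θBal F.L γ (cw * b₀) p₀ J) V →
        G F J V →
        ∀ U₀ ∈ {U' : GaugeField (F.P K) 0 (Matrix.specialUnitaryGroup (Fin 2) ℂ) | U' ∈ fibre F ℰp J K hJK V ∧ U' ∈ histGood F ℰp (θBal F.L γ b₀ p₀) K J ∧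
            wilsonAction4 U' = minActionRegPr F J K hJK ε₀ V},
        ∃ (DM : (PBond (F.P K) 0 → EuclideanSpace ℝ (Fin 3)) → (PBond (F.P J) 0 → EuclideanSpace ℝ (Fin 3)))
          (lam : (PBond (F.P J) 0 → EuclideanSpace ℝ (Fin 3)) → ℝ),
          (∀ ζ : PBond (F.P K) 0 → EuclideanSpace ℝ (Fin 3),
            (∑ p : Plaq (F.P K) 0, inner ℝ (imVec (su2Quat (GaugeField.plaqHol U₀ p)))
              (adSU2 (GaugeField.plaqHol U₀ p)⁻¹ (ζ ⟨p.src, p.μ⟩) + adSU2 ((GaugeField.plaqHol U₀ p)⁻¹ * U₀ ⟨p.src, p.μ⟩) (ζ ⟨p.src.shift p.μ, p.ν⟩) -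
                adSU2 ((GaugeField.plaqHol U₀ p)⁻¹ * U₀ ⟨p.src, p.μ⟩ * U₀ ⟨p.src.shift p.μ, p.ν⟩ * (U₀ ⟨p.src.shift p.ν, p.μ⟩)⁻¹) (ζ ⟨p.src.shift p.ν, p.μ⟩) -
                ζ ⟨p.src, p.ν⟩)) = lam (DM ζ)) ∧
          (∀ v : PBond (F.P J) 0 → EuclideanSpace ℝ (Fin 3),
            |lam v| ≤ C_lam * θBal F.L γ b₀ p₀ J * ((F.L : ℝ)⁻¹) ^ (K - J) * ∑ B : PBond (F.P J) 0, ‖v B‖) ∧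
          ∀ U ∈ fibre F ℰp J K hJK V, U ∈ histGood F ℰp (θBal F.L γ b₀ p₀) K J →
            Ax F J K hJK U U₀ →
            ∑ B : PBond (F.P J) 0, ‖DM (fun ℓ => imVec (su2Quat (U ℓ * (U₀ ℓ)⁻¹))) B‖ ≤
              C_M * (((F.L : ℝ)⁻¹) ^ (K - J) * ∑ ℓ : PBond (F.P K) 0, dist1 (U ℓ * (U₀ ℓ)⁻¹) ^ 2 +
                (F.L : ℝ) ^ (K - J) * ∑ p : Plaq (F.P K) 0, (1 - reTr ((GaugeField.plaqHol U₀ p)⁻¹ * GaugeField.plaqHol U p))) :=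
  multAx_of_preimages G Ax (pre_of_letters hT G Ax hR hM) (bkgLetter_of_thm1Pair hT G)

/-- ★★★ **«MULT♭-ax» ⟸ the `L = 3` Thm-1 pair ∧ (RINV-curl)_q ∧ AVG₂♭-ax_q.** [cite: Balaban1987RG1, (0.21)-(0.22) p.256; Balaban1985Variational, Thm 1 p.279; Balaban1985RegularSpaces, Thm 2 p.83] -/
theorem multAx_of_letters_of_thm1PairAtThree
    (h3 : ∃ a₀ a₁ B₃ : ℝ, 0 < a₀ ∧ 0 < a₁ ∧ 0 < B₃ ∧ Thm1GlobalMinAt 3 a₀ a₁ B₃ ∧ Thm1UniqueMinOrbitAt 3 a₀ a₁ B₃)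
    (G : (F : T3Family) → (J : ℕ) → GaugeField (F.P J) 0 (Matrix.specialUnitaryGroup (Fin 2) ℂ) → Prop)
    (Ax : (F : T3Family) → (J K : ℕ) → (hJK : J ≤ K) → GaugeField (F.P K) 0 (Matrix.specialUnitaryGroup (Fin 2) ℂ) →
      GaugeField (F.P K) 0 (Matrix.specialUnitaryGroup (Fin 2) ℂ) → Prop)
    (hR : ∀ (L : ℕ), ∃ c₀ : ℝ, 0 < c₀ ∧ c₀ ≤ 1 ∧ ∀ (cw : ℝ), 0 < cw → cw ≤ c₀ → ∃ pS : ℝ, ∀ (b₀ p₀ : ℝ), 0 < b₀ → pS ≤ p₀ → 0 < p₀ → ∃ ε₁ : ℝ, 0 < ε₁ ∧ ∀ (ε₀ : ℝ), 0 < ε₀ → ε₀ ≤ ε₁ →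
    ∃ γ₁ : ℝ, 0 < γ₁ ∧ ∃ C_R : ℝ, 0 ≤ C_R ∧ ∀ (F : T3Family) (γ : ℝ), F.L = L → 0 < γ → γ ≤ γ₁ →
      ∀ (J K : ℕ) (hJK : J ≤ K) (V : GaugeField (F.P J) 0 (Matrix.specialUnitaryGroup (Fin 2) ℂ)), PlaqSmall (θBal F.L γ (cw * b₀) p₀ J) V →
        G F J V →
        ∀ U₀ ∈ {U' : GaugeField (F.P K) 0 (Matrix.specialUnitaryGroup (Fin 2) ℂ) | U' ∈ fibre F ℰp J K hJK V ∧ U' ∈ histGood F ℰp (θBal F.L γ b₀ p₀) K J ∧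
            wilsonAction4 U' = minActionRegPr F J K hJK ε₀ V},
        ∀ v : PBond (F.P J) 0 → EuclideanSpace ℝ (Fin 3), ∃ ζ : PBond (F.P K) 0 → EuclideanSpace ℝ (Fin 3), (fderiv ℝ (fun (ζ : PBond (F.P K) 0 → EuclideanSpace ℝ (Fin 3)) (B : PBond (F.P J) 0) =>
            imVec (su2Quat (descendTo F ℰp J K hJK (fun ℓ => expPoint (ζ ℓ) * U₀ ℓ) B * (descendTo F ℰp J K hJK U₀ B)⁻¹))) 0) ζ = v ∧
            ∑ p : Plaq (F.P K) 0, ‖adSU2 (GaugeField.plaqHol U₀ p)⁻¹ (ζ ⟨p.src, p.μ⟩) + adSU2 ((GaugeField.plaqHol U₀ p)⁻¹ * U₀ ⟨p.src, p.μ⟩) (ζ ⟨p.src.shift p.μ, p.ν⟩) -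
                  adSU2 ((GaugeField.plaqHol U₀ p)⁻¹ * U₀ ⟨p.src, p.μ⟩ * U₀ ⟨p.src.shift p.μ, p.ν⟩ * (U₀ ⟨p.src.shift p.ν, p.μ⟩)⁻¹) (ζ ⟨p.src.shift p.ν, p.μ⟩) -
                  ζ ⟨p.src, p.ν⟩‖ ≤
              C_R * (F.L : ℝ) ^ (K - J) * ∑ B : PBond (F.P J) 0, ‖v B‖)
    (hM : ∀ (L : ℕ), ∃ c₀ : ℝ, 0 < c₀ ∧ c₀ ≤ 1 ∧ ∀ (cw : ℝ), 0 < cw → cw ≤ c₀ → ∃ pS : ℝ, ∀ (b₀ p₀ : ℝ), 0 < b₀ → pS ≤ p₀ → 0 < p₀ → ∃ ε₁ : ℝ, 0 < ε₁ ∧ ∀ (ε₀ : ℝ), 0 < ε₀ → ε₀ ≤ ε₁ →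
    ∃ γ₁ : ℝ, 0 < γ₁ ∧ ∃ C_M : ℝ, 0 ≤ C_M ∧ ∀ (F : T3Family) (γ : ℝ), F.L = L → 0 < γ → γ ≤ γ₁ →
      ∀ (J K : ℕ) (hJK : J ≤ K) (V : GaugeField (F.P J) 0 (Matrix.specialUnitaryGroup (Fin 2) ℂ)), PlaqSmall (θBal F.L γ (cw * b₀) p₀ J) V →
        G F J V →
        ∀ U₀ ∈ {U' : GaugeField (F.P K) 0 (Matrix.specialUnitaryGroup (Fin 2) ℂ) | U' ∈ fibre F ℰp J K hJK V ∧ U' ∈ histGood F ℰp (θBal F.L γ b₀ p₀) K J ∧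
            wilsonAction4 U' = minActionRegPr F J K hJK ε₀ V},
        ∀ U ∈ fibre F ℰp J K hJK V, U ∈ histGood F ℰp (θBal F.L γ b₀ p₀) K J →
            Ax F J K hJK U U₀ →
            ∑ B : PBond (F.P J) 0, ‖(fderiv ℝ (fun (ζ : PBond (F.P K) 0 → EuclideanSpace ℝ (Fin 3)) (B : PBond (F.P J) 0) =>
            imVec (su2Quat (descendTo F ℰp J K hJK (fun ℓ => expPoint (ζ ℓ) * U₀ ℓ) B * (descendTo F ℰp J K hJK U₀ B)⁻¹))) 0) (fun ℓ => imVec (su2Quat (U ℓ * (U₀ ℓ)⁻¹))) B‖ ≤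
              C_M * (((F.L : ℝ)⁻¹) ^ (K - J) * ∑ ℓ : PBond (F.P K) 0, dist1 (U ℓ * (U₀ ℓ)⁻¹) ^ 2 +
                (F.L : ℝ) ^ (K - J) * ∑ p : Plaq (F.P K) 0, (1 - reTr ((GaugeField.plaqHol U₀ p)⁻¹ * GaugeField.plaqHol U p)))) :
    ∀ (L : ℕ), ∃ c₀ : ℝ, 0 < c₀ ∧ c₀ ≤ 1 ∧ ∀ (cw : ℝ), 0 < cw → cw ≤ c₀ → ∃ pS : ℝ, ∀ (b₀ p₀ : ℝ), 0 < b₀ → pS ≤ p₀ → 0 < p₀ → ∃ ε₁ : ℝ, 0 < ε₁ ∧ ∀ (ε₀ : ℝ), 0 < ε₀ → ε₀ ≤ ε₁ →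
    ∃ γ₁ : ℝ, 0 < γ₁ ∧ ∃ C_lam : ℝ, 0 ≤ C_lam ∧ ∃ C_M : ℝ, 0 ≤ C_M ∧ ∀ (F : T3Family) (γ : ℝ), F.L = L → 0 < γ → γ ≤ γ₁ →
      ∀ (J K : ℕ) (hJK : J ≤ K) (V : GaugeField (F.P J) 0 (Matrix.specialUnitaryGroup (Fin 2) ℂ)), PlaqSmall (θBal F.L γ (cw * b₀) p₀ J) V →
        G F J V →
        ∀ U₀ ∈ {U' : GaugeField (F.P K) 0 (Matrix.specialUnitaryGroup (Fin 2) ℂ) | U' ∈ fibre F ℰp J K hJK V ∧ U' ∈ histGood F ℰp (θBal F.L γ b₀ p₀) K J ∧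
            wilsonAction4 U' = minActionRegPr F J K hJK ε₀ V},
        ∃ (DM : (PBond (F.P K) 0 → EuclideanSpace ℝ (Fin 3)) → (PBond (F.P J) 0 → EuclideanSpace ℝ (Fin 3)))
          (lam : (PBond (F.P J) 0 → EuclideanSpace ℝ (Fin 3)) → ℝ),
          (∀ ζ : PBond (F.P K) 0 → EuclideanSpace ℝ (Fin 3),
            (∑ p : Plaq (F.P K) 0, inner ℝ (imVec (su2Quat (GaugeField.plaqHol U₀ p)))
              (adSU2 (GaugeField.plaqHol U₀ p)⁻¹ (ζ ⟨p.src, p.μ⟩) + adSU2 ((GaugeField.plaqHol U₀ p)⁻¹ * U₀ ⟨p.src, p.μ⟩) (ζ ⟨p.src.shift p.μ, p.ν⟩) -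
                adSU2 ((GaugeField.plaqHol U₀ p)⁻¹ * U₀ ⟨p.src, p.μ⟩ * U₀ ⟨p.src.shift p.μ, p.ν⟩ * (U₀ ⟨p.src.shift p.ν, p.μ⟩)⁻¹) (ζ ⟨p.src.shift p.ν, p.μ⟩) -
                ζ ⟨p.src, p.ν⟩)) = lam (DM ζ)) ∧
          (∀ v : PBond (F.P J) 0 → EuclideanSpace ℝ (Fin 3),
            |lam v| ≤ C_lam * θBal F.L γ b₀ p₀ J * ((F.L : ℝ)⁻¹) ^ (K - J) * ∑ B : PBond (F.P J) 0, ‖v B‖) ∧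
          ∀ U ∈ fibre F ℰp J K hJK V, U ∈ histGood F ℰp (θBal F.L γ b₀ p₀) K J →
            Ax F J K hJK U U₀ →
            ∑ B : PBond (F.P J) 0, ‖DM (fun ℓ => imVec (su2Quat (U ℓ * (U₀ ℓ)⁻¹))) B‖ ≤
              C_M * (((F.L : ℝ)⁻¹) ^ (K - J) * ∑ ℓ : PBond (F.P K) 0, dist1 (U ℓ * (U₀ ℓ)⁻¹) ^ 2 +
                (F.L : ℝ) ^ (K - J) * ∑ p : Plaq (F.P K) 0, (1 - reTr ((GaugeField.plaqHol U₀ p)⁻¹ * GaugeField.plaqHol U p))) :=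
  multAx_of_letters (thm1Pair_allL_of_three h3) G Ax hR hM

end Summit.QuantumFields.YangMills.Theorems.FluctuationComparisonRegPrIntLS2BetaPreOfLetters

end
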